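import Literature.Barriers.AtomisticToContinuum.DisorderedHarmonicChainPotential
import Mathlib.Analysis.SpecialFunctions.Trigonometric.Bounds
import HarnessLib

/-!
# Ajanki–Huveneers 2011, App. 7.3: the Fourier multiplier `λ(y', ξ)` of one frozen step — moments, differences, Gaussian bound

Third support file of the provefact unit for `AjankiHuveneers2011_approxKernels` (Lemma 5.2,
eqs. (5.9)–(5.10) of O. Ajanki, F. Huveneers, CMP **301** (2011) 841–883, arXiv:1003.1076,
vendored in `DisorderedHarmonicChainPotential.lean`). The frozen-step operator `T_{y'}` of (5.6),
`T_{y'}u(x) = ∫ u(x + ϑ + Φ(y',b))(1 + wh(y')b)τ(b)db`, is convolution on `𝕋` with the law of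
`ϑ + Φ(y', B)` under the weight `ω(b) = (1 + wh(y')b)τ(b)`; its Fourier multiplier is
`e^{2πiξw} λ(y', ξ)` with the CENTRED multiplier (App. 7.3, "`λ_k(z) = ∫ e^{i2πzw⁻¹(ϑ - w + Φ(y_k,b))}
(1 + wγ_k b)τ(b)db`", `z = ξw`)

  `λ(y', ξ) = ∫ e^{2πiξ c(b)} ω(b) db`,  `c(b) = ϑ(w) - w + Φ(y', b)`  (`ahLam`, `ahC`, `ahWt`).

PROVED here, with constants depending only on the reduced law `τ` and `‖h‖_∞` (uniform in `y'`):
* plumbing: a window `[j₁, j₂]` where `τ ≥ ε₂ > 0` (`ReducedLawHyp.exists_lower_window`), positive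
  variance `σ² = ∫ b²τ > 0`, the weight is a probability density for small `w` (`integral_ahWt`,
  `ahWt_nonneg`), its moments `∫ bω = wh(y')σ²`, `∫ b²ω = σ² + 𝒪(w)`; the centred phase satisfies
  `c(b) = w sin²(πy') b + 𝒪(w²)`, `|c| = 𝒪(w)` (`ahC_estimates`, from the expansion (3.11) of `Φ`);
* `|λ| ≤ 1` (`norm_ahLam_le_one`);
* the difference forms of the paper's `|∂_zλ_k(z)| = 𝒪(w + |z|)`, `|∂²_zλ_k(z)| = 𝒪(1)` (eqs.
  `λ-loc2/3`): `|λ(ξ+1) - λ(ξ)| ≤ C₁w²(1 + |ξ|)` (`norm_ahLam_succ_sub_le`; the gain comes from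
  `∫ cω = 𝒪(w²)`, i.e. `∫ bτ = 0`) and `|λ(ξ+2) - 2λ(ξ+1) + λ(ξ)| ≤ C₂w²` (`norm_ahLam_second_diff_le`);
* the Gaussian bound `λ-loc1` in quantitative form: for `|ξ|w ≤ ε₀`,
  `|λ(y', ξ)|² ≤ 1 - (3/2)π²σ² sin⁴(πy') (ξw)² + C_E w (ξw)²` (`norm_sq_ahLam_le`; second-order
  Taylor expansion of `e^{iθ}`, the imaginary part being `𝒪(w|z|)` and entering squared).

The decay and strict bounds on good factors (`|∂ˡ_zλ_k| ≤ C/z`, `|λ_k| ≤ 1 - ε₁`) are in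
`DisorderedHarmonicChainApproxKernelsDecay.lean`. No named facts are introduced.
-/

noncomputable section

open MeasureTheory Real Complex Set

namespace Literature.Barriers.AtomisticToContinuum.HeatConduction

/-! ### The Fourier multiplier of one frozen step `T_{y'}` -/

/-- The centred phase increment `c(b) = ϑ(w) - w + Φ(y', b)` (`= f_b(y') - y' - w = wφ(y')b + 𝒪(w²)`).
[cite: AjankiHuveneers2011, App. 7.3 (def. of `λ_k`)] -/
def ahC (w y' b : ℝ) : ℝ := ahTheta w - w + ahPhi w y' b

/-- The weight `ω(b) = (1 + w h(y') b) τ(b)` of the frozen step `T_{y'}` (a probability density for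
small `w`). [cite: AjankiHuveneers2011, §5 eq. (5.6)] -/
def ahWt (τ : ℝ → ℝ) (w : ℝ) (h : ℝ → ℝ) (y' b : ℝ) : ℝ := (1 + w * h y' * b) * τ b

/-- **The multiplier `λ(y', ξ) = ∫ e^{2πiξ c(b)} ω(b) db`** of the convolution operator `T_{y'}`
(the paper's `λ_k(ξw)` for `y' = y_k`, App. 7.3 eq. (7.x) "`λ_k(z) = ∫ e^{i2πzw⁻¹(ϑ - w + Φ(y_k,b))}
(1 + wγ_k b)τ(b)db`"). [cite: AjankiHuveneers2011, App. 7.3] -/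
def ahLam (τ : ℝ → ℝ) (w : ℝ) (h : ℝ → ℝ) (y' : ℝ) (ξ : ℤ) : ℂ :=
  ∫ b, cexp (2 * π * I * ξ * ahC w y' b) * (ahWt τ w h y' b : ℂ)

section Setup

variable {τ : ℝ → ℝ} {bm bp : ℝ}

/-! #### The reduced law: a window where `τ` is bounded below, positive variance -/

/-- **A window of positive density**: `τ ≥ ε₂ > 0` on some interval `[j₁, j₂] ⊆ [b₋, b₊]` of positive
length (`τ` is continuous on its support and has mass one). [cite: AjankiHuveneers2011, App. 7.3
("By continuity of `τ`, one finds an interval `J` on which `τ ≥ ε₂`")] -/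
theorem ReducedLawHyp.exists_lower_window (hτ : ReducedLawHyp τ bm bp) :
    ∃ j₁ j₂ ε₂ : ℝ, bm ≤ j₁ ∧ j₁ < j₂ ∧ j₂ ≤ bp ∧ 0 < ε₂ ∧ ∀ b ∈ Icc j₁ j₂, ε₂ ≤ τ b := by
  -- some point of positive density
  have hpos : ∃ b₀ ∈ Icc bm bp, 0 < τ b₀ := by
    by_contra hcon
    push Not at hcon
    have hzero : ∀ b, τ b = 0 := fun b => by
      by_cases hb : b ∈ Icc bm bp
      · exact le_antisymm (hcon b hb) (hτ.nonneg b)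
      · exact hτ.eq_zero b hb
    have := hτ.integral_eq_one
    simp [hzero] at this
  obtain ⟨b₀, hb₀, hτb₀⟩ := hpos
  -- continuity within the support
  have hc := hτ.continuousOn b₀ hb₀
  rw [Metric.continuousWithinAt_iff] at hc
  obtain ⟨δ, hδ, hδc⟩ := hc (τ b₀ / 2) (by linarith)
  -- the window
  refine ⟨max bm (b₀ - δ / 2), min bp (b₀ + δ / 2), τ b₀ / 2, le_max_left _ _, ?_, min_le_left _ _,
    by linarith, fun b hb => ?_⟩
  · have h1 := hτ.lt
    rcases hb₀ with ⟨h2, h3⟩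
    apply max_lt <;> apply lt_min <;> linarith
  · obtain ⟨hb1, hb2⟩ := hb
    have hbI : b ∈ Icc bm bp := ⟨(le_max_left _ _).trans hb1, hb2.trans (min_le_left _ _)⟩
    have hbd : dist b b₀ < δ := by
      rw [Real.dist_eq, abs_lt]
      constructor <;> [linarith [le_max_right bm (b₀ - δ / 2)]; linarith [min_le_right bp (b₀ + δ / 2)]]
    have := hδc hbI hbd
    rw [Real.dist_eq, abs_lt] at this
    linarith [this.1]

/-- **Positive variance**: `σ² = ∫ b² τ(b) db > 0`. [cite: AjankiHuveneers2011, App. 7.3 (`𝔼(B²)` in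
(7.x))] -/
theorem ReducedLawHyp.variance_pos (hτ : ReducedLawHyp τ bm bp) : 0 < ∫ b, b ^ 2 * τ b := by
  obtain ⟨j₁, j₂, ε₂, hj₁, hj₁₂, hj₂, hε₂, hlow⟩ := hτ.exists_lower_window
  have hint : Integrable fun b => b ^ 2 * τ b :=
    hτ.integrable_mul (by fun_prop) fun b hb => by
      rw [abs_pow]; exact pow_le_pow_left₀ (abs_nonneg _) (ReducedLawHyp.abs_le_of_mem hb) 2
  -- compare with `ε₂ b²` on the window
  set g : ℝ → ℝ := (Icc j₁ j₂).indicator fun b => ε₂ * b ^ 2 with hg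
  have hgi : Integrable g := by
    rw [hg]
    exact (integrable_indicator_iff measurableSet_Icc).mpr
      ((continuous_const.mul (continuous_pow 2)).integrableOn_Icc)
  have hle : ∀ b, g b ≤ b ^ 2 * τ b := fun b => by
    simp only [hg]
    by_cases hb : b ∈ Icc j₁ j₂
    · rw [indicator_of_mem hb]
      nlinarith [hlow b hb, sq_nonneg b]
    · rw [indicator_of_notMem hb]
      exact mul_nonneg (sq_nonneg b) (hτ.nonneg b)
  have hgint : ∫ b, g b = ε₂ * ((j₂ ^ 3 - j₁ ^ 3) / 3) := by
    rw [hg, integral_indicator measurableSet_Icc, integral_Icc_eq_integral_Ioc,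
      ← intervalIntegral.integral_of_le hj₁₂.le, intervalIntegral.integral_const_mul, integral_pow]
    norm_num
  have hgpos : 0 < ∫ b, g b := by
    rw [hgint]
    have : j₁ ^ 3 < j₂ ^ 3 := Odd.strictMono_pow (⟨1, by norm_num⟩ : Odd 3) hj₁₂
    positivity
  exact hgpos.trans_le (integral_mono hgi hint hle)

/-! #### The weight `ω` -/

variable {w : ℝ} {h : ℝ → ℝ} {H : ℝ}

/-- `|w h(y') b| ≤ w H b_*` on the support. [folklore] -/
theorem abs_w_mul_h_mul_le (hw : 0 ≤ w) (hH : ∀ z, |h z| ≤ H) (y' : ℝ) {b : ℝ}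
    (hb : b ∈ Icc bm bp) : |w * h y' * b| ≤ w * H * max |bm| |bp| :=
  abs_weightArg_le hw hH hb

/-- The weight is non-negative once `w H b_* ≤ 1/2`. [folklore] -/
theorem ahWt_nonneg (hτ : ReducedLawHyp τ bm bp) (hw : 0 ≤ w) (hH : ∀ z, |h z| ≤ H)
    (hsmall : w * H * max |bm| |bp| ≤ 1 / 2) (y' b : ℝ) : 0 ≤ ahWt τ w h y' b := by
  unfold ahWt
  by_cases hb : b ∈ Icc bm bp
  · have := abs_le.mp ((abs_w_mul_h_mul_le hw hH y' hb).trans hsmall)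
    exact mul_nonneg (by linarith [this.1]) (hτ.nonneg b)
  · rw [hτ.eq_zero b hb, mul_zero]

/-- `0 ≤ ω ≤ (3/2) τ` once `w H b_* ≤ 1/2`. [folklore] -/
theorem ahWt_le (hτ : ReducedLawHyp τ bm bp) (hw : 0 ≤ w) (hH : ∀ z, |h z| ≤ H)
    (hsmall : w * H * max |bm| |bp| ≤ 1 / 2) (y' b : ℝ) : ahWt τ w h y' b ≤ 3 / 2 * τ b := by
  unfold ahWt
  by_cases hb : b ∈ Icc bm bp
  · have := abs_le.mp ((abs_w_mul_h_mul_le hw hH y' hb).trans hsmall)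
    exact mul_le_mul_of_nonneg_right (by linarith [this.2]) (hτ.nonneg b)
  · rw [hτ.eq_zero b hb, mul_zero, mul_zero]

/-- `ω` vanishes off `[b₋, b₊]`. [folklore] -/
theorem ahWt_eq_zero (hτ : ReducedLawHyp τ bm bp) (y' : ℝ) {b : ℝ} (hb : b ∉ Icc bm bp) :
    ahWt τ w h y' b = 0 := by
  unfold ahWt; rw [hτ.eq_zero b hb, mul_zero]

/-- `ω` is measurable. [folklore] -/
theorem measurable_ahWt (hτ : ReducedLawHyp τ bm bp) (w : ℝ) (h : ℝ → ℝ) (y' : ℝ) :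
    Measurable (ahWt τ w h y') := by
  unfold ahWt
  exact (measurable_const.add (measurable_const.mul measurable_id)).mul hτ.measurable

/-- `∫ ω = 1` (`∫ τ = 1`, `∫ b τ = 0`). [cite: AjankiHuveneers2011, §5 after eq. (5.3)] -/
theorem integral_ahWt (hτ : ReducedLawHyp τ bm bp) (w : ℝ) (h : ℝ → ℝ) (y' : ℝ) :
    ∫ b, ahWt τ w h y' b = 1 := by
  unfold ahWt
  have := hτ.integral_affine 1 (w * h y')
  simpa [mul_assoc] using this

/-- `∫ b ω(b) db = w h(y') σ²`. [cite: AjankiHuveneers2011, App. 7.3 (first moment)] -/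
theorem integral_mul_ahWt (hτ : ReducedLawHyp τ bm bp) (w : ℝ) (h : ℝ → ℝ) (y' : ℝ) :
    ∫ b, b * ahWt τ w h y' b = w * h y' * ∫ b, b ^ 2 * τ b := by
  unfold ahWt
  have h2 : Integrable fun b => b ^ 2 * τ b :=
    hτ.integrable_mul (by fun_prop) fun b hb => by
      rw [abs_pow]; exact pow_le_pow_left₀ (abs_nonneg _) (ReducedLawHyp.abs_le_of_mem hb) 2
  have hsplit : (fun b => b * ((1 + w * h y' * b) * τ b)) =
      fun b => b * τ b + (w * h y') * (b ^ 2 * τ b) := by funext b; ring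
  rw [hsplit, integral_add hτ.integrable_id_mul (h2.const_mul _), integral_const_mul, hτ.mean_zero,
    zero_add]

/-- `∫ b² ω(b) db = σ² + w h(y') ∫ b³ τ`. [cite: AjankiHuveneers2011, App. 7.3 (second moment)] -/
theorem integral_sq_mul_ahWt (hτ : ReducedLawHyp τ bm bp) (w : ℝ) (h : ℝ → ℝ) (y' : ℝ) :
    ∫ b, b ^ 2 * ahWt τ w h y' b = (∫ b, b ^ 2 * τ b) + w * h y' * ∫ b, b ^ 3 * τ b := by
  unfold ahWt
  have h2 : Integrable fun b => b ^ 2 * τ b :=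
    hτ.integrable_mul (by fun_prop) fun b hb => by
      rw [abs_pow]; exact pow_le_pow_left₀ (abs_nonneg _) (ReducedLawHyp.abs_le_of_mem hb) 2
  have h3 : Integrable fun b => b ^ 3 * τ b :=
    hτ.integrable_mul (by fun_prop) fun b hb => by
      rw [abs_pow]; exact pow_le_pow_left₀ (abs_nonneg _) (ReducedLawHyp.abs_le_of_mem hb) 3
  have hsplit : (fun b => b ^ 2 * ((1 + w * h y' * b) * τ b)) =
      fun b => b ^ 2 * τ b + (w * h y') * (b ^ 3 * τ b) := by funext b; ring
  rw [hsplit, integral_add h2 (h3.const_mul _), integral_const_mul]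

/-- Moments of `τ`: `|∫ bᵏ τ| ≤ b_*ᵏ`. [folklore] -/
theorem abs_integral_pow_mul_le (hτ : ReducedLawHyp τ bm bp) (k : ℕ) :
    |∫ b, b ^ k * τ b| ≤ max |bm| |bp| ^ k := by
  have hk : Integrable fun b => b ^ k * τ b :=
    hτ.integrable_mul (by fun_prop) fun b hb => by
      rw [abs_pow]; exact pow_le_pow_left₀ (abs_nonneg _) (ReducedLawHyp.abs_le_of_mem hb) k
  calc |∫ b, b ^ k * τ b| ≤ ∫ b, |b ^ k * τ b| := abs_integral_le_integral_abs
    _ ≤ ∫ b, max |bm| |bp| ^ k * τ b := by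
        refine integral_mono hk.abs (hτ.integrable.const_mul _) fun b => ?_
        by_cases hb : b ∈ Icc bm bp
        · rw [abs_mul, abs_of_nonneg (hτ.nonneg b), abs_pow]
          exact mul_le_mul_of_nonneg_right
            (pow_le_pow_left₀ (abs_nonneg _) (ReducedLawHyp.abs_le_of_mem hb) k) (hτ.nonneg b)
        · simp [hτ.eq_zero b hb]
    _ = max |bm| |bp| ^ k := by rw [integral_const_mul, hτ.integral_eq_one, mul_one]

/-! #### The centred phase `c(b)` -/

/-- **`c(b) = wφ(y')b + 𝒪(w²)`, `|c(b)| = 𝒪(w)`** uniformly in `y'` and `b ∈ [b₋, b₊]`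
(`φ = sin²(π·)`; from the expansion (3.11) of `Φ` and `w ≤ ϑ ≤ w + w³`).
[cite: AjankiHuveneers2011, Lemma 3.2 eq. (3.11), §5 eq. (5.7)] -/
theorem ahC_estimates (bm bp : ℝ) :
    ∃ w₀ : ℝ, 0 < w₀ ∧ w₀ ≤ 1 ∧ ∃ A₂ : ℝ, 0 ≤ A₂ ∧ ∀ w ∈ Ioc 0 w₀, ∀ y' : ℝ, ∀ b ∈ Icc bm bp,
      |ahC w y' b - w * Real.sin (π * y') ^ 2 * b| ≤ A₂ * w ^ 2 ∧
      |ahC w y' b| ≤ (max |bm| |bp| + A₂) * w := by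
  obtain ⟨w₁, hw₁, C, hC⟩ := ahPhi_expansion bm bp
  set M := max |bm| |bp| with hM
  have hM0 : 0 ≤ M := le_max_of_le_left (abs_nonneg _)
  refine ⟨min w₁ (1 / 5), lt_min hw₁ (by norm_num), (min_le_right _ _).trans (by norm_num),
    1 + π * M ^ 2 / 2 + |C| * M, by positivity, ?_⟩
  intro w hw y' b hb
  obtain ⟨hw0, hwle⟩ := hw
  have hw1 : w ≤ w₁ := hwle.trans (min_le_left _ _)
  have hw5 : w ≤ 1 / 5 := hwle.trans (min_le_right _ _)
  have hwone : w ≤ 1 := by linarith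
  have hbM : |b| ≤ M := ReducedLawHyp.abs_le_of_mem hb
  have hΦ := hC w ⟨hw0, hw1⟩ y' b hb
  have hθ1 := ahTheta_ge hw0.le (by nlinarith [Real.pi_lt_d2] : π * w ≤ 2)
  have hθ2 := ahTheta_le hw0.le hw5
  have hS1 : Real.sin (π * y') ^ 2 ≤ 1 := Real.sin_sq_le_one _
  have hS0 : 0 ≤ Real.sin (π * y') ^ 2 := sq_nonneg _
  -- the second-order term and the remainder
  have h2 : |Real.sin (π * y') ^ 2 * (w ^ 2 * b ^ 2 * (π / 2) * Real.sin (2 * π * y'))| ≤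
      π * M ^ 2 / 2 * w ^ 2 := by
    rw [abs_mul, abs_of_nonneg hS0, abs_mul, abs_mul, abs_mul, abs_of_nonneg (sq_nonneg w),
      abs_of_nonneg (sq_nonneg b), abs_of_nonneg (by positivity : (0 : ℝ) ≤ π / 2)]
    have hb2 : b ^ 2 ≤ M ^ 2 := by rw [← sq_abs]; exact pow_le_pow_left₀ (abs_nonneg _) hbM 2
    calc Real.sin (π * y') ^ 2 * (w ^ 2 * b ^ 2 * (π / 2) * |Real.sin (2 * π * y')|)
        ≤ 1 * (w ^ 2 * M ^ 2 * (π / 2) * 1) := by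
          gcongr
          exact Real.abs_sin_le_one _
      _ = π * M ^ 2 / 2 * w ^ 2 := by ring
  have h3 : C * w ^ 3 * |b| * Real.sin (π * y') ^ 2 ≤ |C| * M * w ^ 2 := by
    calc C * w ^ 3 * |b| * Real.sin (π * y') ^ 2 ≤ |C| * w ^ 3 * |b| * Real.sin (π * y') ^ 2 := by
          gcongr; exact le_abs_self C
      _ ≤ |C| * w ^ 2 * M * 1 := by
          have : w ^ 3 ≤ w ^ 2 := by nlinarith
          gcongr
      _ = |C| * M * w ^ 2 := by ring
  have hmain : |ahC w y' b - w * Real.sin (π * y') ^ 2 * b| ≤ (1 + π * M ^ 2 / 2 + |C| * M) * w ^ 2 := by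
    have hsplit : ahC w y' b - w * Real.sin (π * y') ^ 2 * b =
        (ahTheta w - w) + (ahPhi w y' b - Real.sin (π * y') ^ 2 *
          (w * b + w ^ 2 * b ^ 2 * (π / 2) * Real.sin (2 * π * y'))) +
        Real.sin (π * y') ^ 2 * (w ^ 2 * b ^ 2 * (π / 2) * Real.sin (2 * π * y')) := by
      unfold ahC; ring
    rw [hsplit]
    have hθ : |ahTheta w - w| ≤ 1 * w ^ 2 := by
      rw [abs_of_nonneg (by linarith)]
      nlinarith
    calc _ ≤ |ahTheta w - w| + |ahPhi w y' b - Real.sin (π * y') ^ 2 *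
          (w * b + w ^ 2 * b ^ 2 * (π / 2) * Real.sin (2 * π * y'))| +
          |Real.sin (π * y') ^ 2 * (w ^ 2 * b ^ 2 * (π / 2) * Real.sin (2 * π * y'))| :=
          abs_add_three _ _ _
      _ ≤ 1 * w ^ 2 + |C| * M * w ^ 2 + π * M ^ 2 / 2 * w ^ 2 := add_le_add_three hθ (hΦ.trans h3) h2
      _ = (1 + π * M ^ 2 / 2 + |C| * M) * w ^ 2 := by ring
  refine ⟨hmain, ?_⟩
  have hlin : |w * Real.sin (π * y') ^ 2 * b| ≤ M * w := by
    rw [abs_mul, abs_mul, abs_of_pos hw0, abs_of_nonneg hS0]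
    calc w * Real.sin (π * y') ^ 2 * |b| ≤ w * 1 * M := by gcongr
      _ = M * w := by ring
  have hw2 : (1 + π * M ^ 2 / 2 + |C| * M) * w ^ 2 ≤ (1 + π * M ^ 2 / 2 + |C| * M) * w := by
    have : w ^ 2 ≤ w := by nlinarith
    exact mul_le_mul_of_nonneg_left this (by positivity)
  calc |ahC w y' b| = |(ahC w y' b - w * Real.sin (π * y') ^ 2 * b) + w * Real.sin (π * y') ^ 2 * b| := by
        ring_nf
    _ ≤ |ahC w y' b - w * Real.sin (π * y') ^ 2 * b| + |w * Real.sin (π * y') ^ 2 * b| := abs_add_le _ _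
    _ ≤ (1 + π * M ^ 2 / 2 + |C| * M) * w + M * w := add_le_add (hmain.trans hw2) hlin
    _ = (M + (1 + π * M ^ 2 / 2 + |C| * M)) * w := by ring

/-- `c` is measurable in `b`. [folklore] -/
theorem measurable_ahC (w y' : ℝ) : Measurable (ahC w y') := by
  unfold ahC
  exact measurable_const.add (measurable_ahPhi_right w y')

/-! #### Integrability against `ω` and the basic bound `|λ| ≤ 1` -/

/-- The phase factor as `e^{(real)·i}`. [folklore] -/
theorem cexp_phase_eq (ξ : ℤ) (c : ℝ) :
    cexp (2 * π * I * ξ * c) = cexp (((2 * π * ξ * c : ℝ)) * I) := by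
  congr 1; push_cast; ring

/-- `|e^{2πiξc}| = 1`. [folklore] -/
theorem norm_cexp_phase (ξ : ℤ) (c : ℝ) : ‖cexp (2 * π * I * ξ * c)‖ = 1 := by
  rw [cexp_phase_eq, Complex.norm_exp_ofReal_mul_I]

/-- Bounded measurable complex functions are integrable against `ω`. [folklore] -/
theorem integrable_mul_ahWt (hτ : ReducedLawHyp τ bm bp) (w : ℝ) (h : ℝ → ℝ) (y' : ℝ)
    {g : ℝ → ℂ} (hg : Measurable g) {C : ℝ} (hC : ∀ b ∈ Icc bm bp, ‖g b‖ ≤ C) :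
    Integrable fun b => g b * (ahWt τ w h y' b : ℂ) := by
  have hdom : Integrable fun b => C * (1 + |w| * |h y'| * max |bm| |bp|) * ‖τ b‖ :=
    (hτ.integrable.norm.const_mul _)
  refine hdom.mono' (hg.mul (Complex.measurable_ofReal.comp (measurable_ahWt hτ w h y'))).aestronglyMeasurable
    (ae_of_all _ fun b => ?_)
  by_cases hb : b ∈ Icc bm bp
  · rw [norm_mul, Complex.norm_real, Real.norm_eq_abs, Real.norm_eq_abs]
    unfold ahWt
    rw [abs_mul]
    have h1 : |1 + w * h y' * b| ≤ 1 + |w| * |h y'| * max |bm| |bp| := by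
      calc |1 + w * h y' * b| ≤ |(1 : ℝ)| + |w * h y' * b| := abs_add_le _ _
        _ = 1 + |w| * |h y'| * |b| := by rw [abs_one, abs_mul, abs_mul]
        _ ≤ 1 + |w| * |h y'| * max |bm| |bp| := by
            gcongr; exact ReducedLawHyp.abs_le_of_mem hb
    have hC0 : 0 ≤ C := (norm_nonneg _).trans (hC b hb)
    calc ‖g b‖ * (|1 + w * h y' * b| * |τ b|) ≤ C * ((1 + |w| * |h y'| * max |bm| |bp|) * |τ b|) :=
          mul_le_mul (hC b hb) (mul_le_mul_of_nonneg_right h1 (abs_nonneg _)) (by positivity) hC0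
      _ = C * (1 + |w| * |h y'| * max |bm| |bp|) * |τ b| := by ring
  · rw [ahWt_eq_zero hτ y' hb, hτ.eq_zero b hb]
    simp

/-- Bounded measurable real functions are integrable against `ω`. [folklore] -/
theorem integrable_real_mul_ahWt (hτ : ReducedLawHyp τ bm bp) (w : ℝ) (h : ℝ → ℝ) (y' : ℝ)
    {g : ℝ → ℝ} (hg : Measurable g) {C : ℝ} (hC : ∀ b ∈ Icc bm bp, |g b| ≤ C) :
    Integrable fun b => g b * ahWt τ w h y' b := by
  have hdom : Integrable fun b => C * (1 + |w| * |h y'| * max |bm| |bp|) * ‖τ b‖ :=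
    (hτ.integrable.norm.const_mul _)
  refine hdom.mono' (hg.mul (measurable_ahWt hτ w h y')).aestronglyMeasurable
    (ae_of_all _ fun b => ?_)
  by_cases hb : b ∈ Icc bm bp
  · rw [Real.norm_eq_abs, Real.norm_eq_abs]
    unfold ahWt
    rw [abs_mul, abs_mul]
    have h1 : |1 + w * h y' * b| ≤ 1 + |w| * |h y'| * max |bm| |bp| := by
      calc |1 + w * h y' * b| ≤ |(1 : ℝ)| + |w * h y' * b| := abs_add_le _ _
        _ = 1 + |w| * |h y'| * |b| := by rw [abs_one, abs_mul, abs_mul]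
        _ ≤ 1 + |w| * |h y'| * max |bm| |bp| := by
            gcongr; exact ReducedLawHyp.abs_le_of_mem hb
    have hC0 : 0 ≤ C := (abs_nonneg _).trans (hC b hb)
    calc |g b| * (|1 + w * h y' * b| * |τ b|) ≤ C * ((1 + |w| * |h y'| * max |bm| |bp|) * |τ b|) :=
          mul_le_mul (hC b hb) (mul_le_mul_of_nonneg_right h1 (abs_nonneg _)) (by positivity) hC0
      _ = C * (1 + |w| * |h y'| * max |bm| |bp|) * |τ b| := by ring
  · rw [ahWt_eq_zero hτ y' hb, hτ.eq_zero b hb]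
    simp

/-- `ω` is integrable. [folklore] -/
theorem integrable_ahWt (hτ : ReducedLawHyp τ bm bp) (w : ℝ) (h : ℝ → ℝ) (y' : ℝ) :
    Integrable (ahWt τ w h y') := by
  have := integrable_real_mul_ahWt hτ w h y' (g := fun _ => (1 : ℝ)) measurable_const (C := 1)
    (fun b _ => by simp)
  simpa using this

/-- The integrand of `λ` is integrable. [folklore] -/
theorem integrable_ahLam_integrand (hτ : ReducedLawHyp τ bm bp) (w : ℝ) (h : ℝ → ℝ) (y' : ℝ)
    (ξ : ℤ) : Integrable fun b => cexp (2 * π * I * ξ * ahC w y' b) * (ahWt τ w h y' b : ℂ) :=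
  integrable_mul_ahWt hτ w h y' ((Complex.measurable_ofReal.comp (measurable_ahC w y')).const_mul
    (2 * π * I * ξ) |>.cexp) (C := 1) fun _ _ => (norm_cexp_phase ξ _).le

/-- **`|λ| ≤ 1`** ("`|λ_k(z)| ≤ 1` for every `k` and `z`, which follows from the definition": the
weight is a probability density once `w‖h‖_∞ b_* ≤ 1/2`). [cite: AjankiHuveneers2011, App. 7.3] -/
theorem norm_ahLam_le_one (hτ : ReducedLawHyp τ bm bp) (hw : 0 ≤ w) (hH : ∀ z, |h z| ≤ H)
    (hsmall : w * H * max |bm| |bp| ≤ 1 / 2) (y' : ℝ) (ξ : ℤ) : ‖ahLam τ w h y' ξ‖ ≤ 1 := by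
  unfold ahLam
  calc ‖∫ b, cexp (2 * π * I * ξ * ahC w y' b) * (ahWt τ w h y' b : ℂ)‖
      ≤ ∫ b, ‖cexp (2 * π * I * ξ * ahC w y' b) * (ahWt τ w h y' b : ℂ)‖ :=
        norm_integral_le_integral_norm _
    _ = ∫ b, ahWt τ w h y' b := by
        refine integral_congr_ae (ae_of_all _ fun b => ?_)
        dsimp only
        rw [norm_mul, norm_cexp_phase, one_mul, Complex.norm_real, Real.norm_eq_abs,
          abs_of_nonneg (ahWt_nonneg hτ hw hH hsmall y' b)]
    _ = 1 := integral_ahWt hτ w h y'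

/-! #### First and second differences in `ξ` -/

/-- `λ(ξ+1) - λ(ξ) = ∫ e^{2πiξc}(e^{2πic} - 1) ω`. [cite: AjankiHuveneers2011, App. 7.3] -/
theorem ahLam_succ_sub (hτ : ReducedLawHyp τ bm bp) (w : ℝ) (h : ℝ → ℝ) (y' : ℝ) (ξ : ℤ) :
    ahLam τ w h y' (ξ + 1) - ahLam τ w h y' ξ =
      ∫ b, cexp (2 * π * I * ξ * ahC w y' b) * (cexp (2 * π * I * ahC w y' b) - 1) *
        (ahWt τ w h y' b : ℂ) := by
  unfold ahLam
  rw [← integral_sub (integrable_ahLam_integrand hτ w h y' (ξ + 1))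
    (integrable_ahLam_integrand hτ w h y' ξ)]
  refine integral_congr_ae (ae_of_all _ fun b => ?_)
  dsimp only
  have : cexp (2 * π * I * ((ξ + 1 : ℤ) : ℂ) * ahC w y' b) =
      cexp (2 * π * I * ξ * ahC w y' b) * cexp (2 * π * I * ahC w y' b) := by
    rw [← Complex.exp_add]; congr 1; push_cast; ring
  rw [Int.cast_add, Int.cast_one] at this ⊢
  rw [this]; ring

/-- `λ(ξ+2) - 2λ(ξ+1) + λ(ξ) = ∫ e^{2πiξc}(e^{2πic} - 1)² ω`. [cite: AjankiHuveneers2011, App. 7.3] -/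
theorem ahLam_second_diff (hτ : ReducedLawHyp τ bm bp) (w : ℝ) (h : ℝ → ℝ) (y' : ℝ) (ξ : ℤ) :
    ahLam τ w h y' (ξ + 2) - 2 * ahLam τ w h y' (ξ + 1) + ahLam τ w h y' ξ =
      ∫ b, cexp (2 * π * I * ξ * ahC w y' b) * (cexp (2 * π * I * ahC w y' b) - 1) ^ 2 *
        (ahWt τ w h y' b : ℂ) := by
  have hI : ∀ η : ℤ, Integrable fun b => cexp (2 * π * I * η * ahC w y' b) *
      (cexp (2 * π * I * ahC w y' b) - 1) * (ahWt τ w h y' b : ℂ) := by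
    intro η
    refine integrable_mul_ahWt hτ w h y' ?_ (C := 2) fun b _ => ?_
    · have hm := Complex.measurable_ofReal.comp (measurable_ahC w y')
      fun_prop
    · rw [norm_mul, norm_cexp_phase, one_mul]
      calc ‖cexp (2 * π * I * ahC w y' b) - 1‖ ≤ ‖cexp (2 * π * I * ahC w y' b)‖ + ‖(1 : ℂ)‖ :=
            norm_sub_le _ _
        _ = 2 := by
            rw [show (2 * π * I * ahC w y' b : ℂ) = 2 * π * I * ((1 : ℤ) : ℂ) * ahC w y' b by
              push_cast; ring, norm_cexp_phase, norm_one]; norm_num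
  have h1 := ahLam_succ_sub hτ w h y' (ξ + 1)
  have h0 := ahLam_succ_sub hτ w h y' ξ
  have e : ahLam τ w h y' (ξ + 2) - 2 * ahLam τ w h y' (ξ + 1) + ahLam τ w h y' ξ =
      (ahLam τ w h y' (ξ + 1 + 1) - ahLam τ w h y' (ξ + 1)) -
      (ahLam τ w h y' (ξ + 1) - ahLam τ w h y' ξ) := by
    rw [show ξ + 1 + 1 = ξ + 2 by ring]; ring
  rw [e, h1, h0, ← integral_sub (hI (ξ + 1)) (hI ξ)]
  refine integral_congr_ae (ae_of_all _ fun b => ?_)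
  dsimp only
  have : cexp (2 * π * I * ((ξ + 1 : ℤ) : ℂ) * ahC w y' b) =
      cexp (2 * π * I * ξ * ahC w y' b) * cexp (2 * π * I * ahC w y' b) := by
    rw [← Complex.exp_add]; congr 1; push_cast; ring
  rw [Int.cast_add, Int.cast_one] at this ⊢
  rw [this]; ring

/-- `|e^{2πic} - 1| ≤ 2π|c|`. [folklore] -/
theorem norm_cexp_ahC_sub_one_le (c : ℝ) : ‖cexp (2 * π * I * c) - 1‖ ≤ 2 * π * |c| := by
  have : cexp (2 * π * I * c) = cexp (I * ((2 * π * c : ℝ) : ℂ)) := by congr 1; push_cast; ring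
  rw [this]
  refine (Real.norm_exp_I_mul_ofReal_sub_one_le).trans (le_of_eq ?_)
  rw [Real.norm_eq_abs, abs_mul, abs_of_pos (by positivity : (0 : ℝ) < 2 * π)]

/-- `|e^{2πic} - 1 - 2πic| ≤ (2π|c|)²` for `2π|c| ≤ 1`. [folklore] -/
theorem norm_cexp_ahC_sub_one_sub_le {c : ℝ} (hc : 2 * π * |c| ≤ 1) :
    ‖cexp (2 * π * I * c) - 1 - 2 * π * I * c‖ ≤ (2 * π * |c|) ^ 2 := by
  have hn : ‖(2 * π * I * c : ℂ)‖ = 2 * π * |c| := by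
    rw [show (2 * π * I * c : ℂ) = ((2 * π * c : ℝ) : ℂ) * I by push_cast; ring, norm_mul,
      Complex.norm_I, mul_one, Complex.norm_real, Real.norm_eq_abs, abs_mul,
      abs_of_pos (by positivity : (0 : ℝ) < 2 * π)]
  have h := Complex.norm_exp_sub_one_sub_id_le (x := 2 * π * I * c) (by rw [hn]; exact hc)
  rwa [hn] at h

variable {H : ℝ}

/-- **First difference**: `|λ(ξ+1) - λ(ξ)| ≤ C₁ w² (1 + |(ξ : ℝ)|)` with `C₁ = C₁(τ, ‖h‖_∞)` (the paper's
`|∂_zλ_k(z)| = 𝒪(w + |z|)`, in difference form: `∫ c ω = 𝒪(w²)` because `∫ b τ = 0`, and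
`|c| = 𝒪(w)`). [cite: AjankiHuveneers2011, App. 7.3 (eq. after (7.x), `λ-loc2`)] -/
theorem norm_ahLam_succ_sub_le (hτ : ReducedLawHyp τ bm bp) (hH : ∀ z, |h z| ≤ H) :
    ∃ w₀ : ℝ, 0 < w₀ ∧ ∃ C₁ : ℝ, 0 ≤ C₁ ∧ ∀ w ∈ Ioc 0 w₀, ∀ y' : ℝ, ∀ ξ : ℤ,
      ‖ahLam τ w h y' (ξ + 1) - ahLam τ w h y' ξ‖ ≤ C₁ * w ^ 2 * (1 + |(ξ : ℝ)|) := by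
  obtain ⟨w₁, hw₁, hw₁1, A₂, hA₂, hcest⟩ := ahC_estimates bm bp
  set M := max |bm| |bp| with hM
  have hM0 : 0 ≤ M := le_max_of_le_left (abs_nonneg _)
  have hH0 : 0 ≤ H := (abs_nonneg _).trans (hH 0)
  set A₃ := M + A₂ with hA₃
  -- smallness: `2π A₃ w ≤ 1` and `w H M ≤ 1/2`
  set w₀ := min w₁ (min (1 / (2 * π * A₃ + 1)) (1 / (2 * H * M + 1))) with hw₀
  refine ⟨w₀, by positivity, 2 * π * (H * M ^ 2 + A₂) + 8 * π ^ 2 * A₃ ^ 2, by positivity, ?_⟩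
  intro w hw y' ξ
  obtain ⟨hw0, hwle⟩ := hw
  have hww₁ : w ∈ Ioc 0 w₁ := ⟨hw0, hwle.trans (min_le_left _ _)⟩
  have hw1 : w ≤ 1 := hww₁.2.trans hw₁1
  have hwA : 2 * π * A₃ * w ≤ 1 := by
    have : w ≤ 1 / (2 * π * A₃ + 1) := hwle.trans ((min_le_right _ _).trans (min_le_left _ _))
    rw [le_div_iff₀ (by positivity)] at this
    nlinarith [mul_nonneg (by positivity : (0:ℝ) ≤ 2 * π * A₃) hw0.le]
  have hwH : w * H * M ≤ 1 / 2 := by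
    have : w ≤ 1 / (2 * H * M + 1) := hwle.trans ((min_le_right _ _).trans (min_le_right _ _))
    rw [le_div_iff₀ (by positivity)] at this
    nlinarith [mul_nonneg (mul_nonneg hw0.le hH0) hM0]
  -- pointwise facts on the support
  have hc : ∀ b ∈ Icc bm bp, |ahC w y' b| ≤ A₃ * w := fun b hb => (hcest w hww₁ y' b hb).2
  have hce : ∀ b ∈ Icc bm bp, |ahC w y' b - w * Real.sin (π * y') ^ 2 * b| ≤ A₂ * w ^ 2 :=
    fun b hb => (hcest w hww₁ y' b hb).1
  -- the remainder `R = (e^{2πiξc} - 1)(e^{2πic} - 1) + (e^{2πic} - 1 - 2πic)`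
  set R : ℝ → ℂ := fun b => (cexp (2 * π * I * ξ * ahC w y' b) - 1) * (cexp (2 * π * I * ahC w y' b) - 1) +
    (cexp (2 * π * I * ahC w y' b) - 1 - 2 * π * I * ahC w y' b) with hR
  have hRm : Measurable R := by
    have hm := Complex.measurable_ofReal.comp (measurable_ahC w y')
    simp only [hR]
    fun_prop
  have hRb : ∀ b ∈ Icc bm bp, ‖R b‖ ≤ (4 * π ^ 2 * A₃ ^ 2 * |(ξ : ℝ)| + 4 * π ^ 2 * A₃ ^ 2) * w ^ 2 := by
    intro b hb
    have hcb := hc b hb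
    have h2πc : 2 * π * |ahC w y' b| ≤ 1 := by nlinarith [Real.pi_pos]
    have t1 : ‖cexp (2 * π * I * ξ * ahC w y' b) - 1‖ ≤ 2 * π * (|(ξ : ℝ)| * (A₃ * w)) := by
      have := norm_cexp_ahC_sub_one_le (ξ * ahC w y' b)
      rw [show (2 * π * I * ((ξ * ahC w y' b : ℝ) : ℂ)) = 2 * π * I * ξ * ahC w y' b by
        push_cast; ring] at this
      refine this.trans ?_
      rw [abs_mul]
      gcongr
    have t2 : ‖cexp (2 * π * I * ahC w y' b) - 1‖ ≤ 2 * π * (A₃ * w) :=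
      (norm_cexp_ahC_sub_one_le _).trans (by gcongr)
    have t3 : ‖cexp (2 * π * I * ahC w y' b) - 1 - 2 * π * I * ahC w y' b‖ ≤ (2 * π * (A₃ * w)) ^ 2 :=
      (norm_cexp_ahC_sub_one_sub_le h2πc).trans (by gcongr)
    calc ‖R b‖ ≤ ‖(cexp (2 * π * I * ξ * ahC w y' b) - 1) * (cexp (2 * π * I * ahC w y' b) - 1)‖ +
          ‖cexp (2 * π * I * ahC w y' b) - 1 - 2 * π * I * ahC w y' b‖ := norm_add_le _ _
      _ ≤ 2 * π * (|(ξ : ℝ)| * (A₃ * w)) * (2 * π * (A₃ * w)) + (2 * π * (A₃ * w)) ^ 2 := by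
          rw [norm_mul]
          exact add_le_add (mul_le_mul t1 t2 (norm_nonneg _) (by positivity)) t3
      _ = (4 * π ^ 2 * A₃ ^ 2 * |(ξ : ℝ)| + 4 * π ^ 2 * A₃ ^ 2) * w ^ 2 := by ring
  -- the first moment `∫ c ω`
  have hcω : |∫ b, ahC w y' b * ahWt τ w h y' b| ≤ (H * M ^ 2 + A₂) * w ^ 2 := by
    have hsplit : (fun b => ahC w y' b * ahWt τ w h y' b) = fun b =>
        (w * Real.sin (π * y') ^ 2) * (b * ahWt τ w h y' b) +
        (ahC w y' b - w * Real.sin (π * y') ^ 2 * b) * ahWt τ w h y' b := by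
      funext b; ring
    have iB : Integrable fun b => b * ahWt τ w h y' b :=
      integrable_real_mul_ahWt hτ w h y' measurable_id (C := M) fun b hb => ReducedLawHyp.abs_le_of_mem hb
    have iE : Integrable fun b => (ahC w y' b - w * Real.sin (π * y') ^ 2 * b) * ahWt τ w h y' b :=
      integrable_real_mul_ahWt hτ w h y' ((measurable_ahC w y').sub (measurable_const.mul measurable_id))
        (C := A₂ * w ^ 2) fun b hb => hce b hb
    rw [hsplit, integral_add (iB.const_mul _) iE, integral_const_mul, integral_mul_ahWt hτ]
    have hσ : |∫ b, b ^ 2 * τ b| ≤ M ^ 2 := abs_integral_pow_mul_le hτ 2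
    have hE : |∫ b, (ahC w y' b - w * Real.sin (π * y') ^ 2 * b) * ahWt τ w h y' b| ≤ A₂ * w ^ 2 := by
      calc _ ≤ ∫ b, |(ahC w y' b - w * Real.sin (π * y') ^ 2 * b) * ahWt τ w h y' b| :=
            abs_integral_le_integral_abs
        _ ≤ ∫ b, A₂ * w ^ 2 * ahWt τ w h y' b := by
            refine integral_mono iE.abs (integrable_real_mul_ahWt hτ w h y' measurable_const
              (C := A₂ * w ^ 2) fun b _ => by rw [abs_of_nonneg (by positivity)]) fun b => ?_
            · by_cases hb : b ∈ Icc bm bp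
              · rw [abs_mul, abs_of_nonneg (ahWt_nonneg hτ hw0.le hH hwH y' b)]
                exact mul_le_mul_of_nonneg_right (hce b hb) (ahWt_nonneg hτ hw0.le hH hwH y' b)
              · rw [ahWt_eq_zero hτ y' hb]; simp
        _ = A₂ * w ^ 2 := by rw [integral_const_mul, integral_ahWt hτ, mul_one]
    have hS1 : Real.sin (π * y') ^ 2 ≤ 1 := Real.sin_sq_le_one _
    calc |w * Real.sin (π * y') ^ 2 * (w * h y' * ∫ b, b ^ 2 * τ b) +
          ∫ b, (ahC w y' b - w * Real.sin (π * y') ^ 2 * b) * ahWt τ w h y' b|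
        ≤ |w * Real.sin (π * y') ^ 2 * (w * h y' * ∫ b, b ^ 2 * τ b)| +
          |∫ b, (ahC w y' b - w * Real.sin (π * y') ^ 2 * b) * ahWt τ w h y' b| := abs_add_le _ _
      _ ≤ w * 1 * (w * H * M ^ 2) + A₂ * w ^ 2 := by
          refine add_le_add ?_ hE
          rw [abs_mul, abs_mul, abs_of_pos hw0, abs_of_nonneg (sq_nonneg _), abs_mul, abs_mul,
            abs_of_pos hw0]
          gcongr
          exact hH y'
      _ = (H * M ^ 2 + A₂) * w ^ 2 := by ring
  -- assemble: `Δλ = 2πi ∫cω + ∫ R ω`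
  have iR := integrable_mul_ahWt hτ w h y' hRm hRb
  have hid : ahLam τ w h y' (ξ + 1) - ahLam τ w h y' ξ =
      2 * π * I * ((∫ b, ahC w y' b * ahWt τ w h y' b : ℝ) : ℂ) + ∫ b, R b * (ahWt τ w h y' b : ℂ) := by
    rw [ahLam_succ_sub hτ, ← integral_complex_ofReal, ← integral_const_mul, ← integral_add ?_ iR]
    · refine integral_congr_ae (ae_of_all _ fun b => ?_)
      simp only [hR]
      push_cast
      ring
    · have hcint : Integrable fun b => ahC w y' b * ahWt τ w h y' b :=
        integrable_real_mul_ahWt hτ w h y' (measurable_ahC w y') (C := A₃ * w) hc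
      exact hcint.ofReal.const_mul _
  rw [hid]
  calc ‖2 * π * I * ((∫ b, ahC w y' b * ahWt τ w h y' b : ℝ) : ℂ) + ∫ b, R b * (ahWt τ w h y' b : ℂ)‖
      ≤ ‖2 * π * I * ((∫ b, ahC w y' b * ahWt τ w h y' b : ℝ) : ℂ)‖ + ‖∫ b, R b * (ahWt τ w h y' b : ℂ)‖ :=
        norm_add_le _ _
    _ ≤ 2 * π * ((H * M ^ 2 + A₂) * w ^ 2) + (4 * π ^ 2 * A₃ ^ 2 * |(ξ : ℝ)| + 4 * π ^ 2 * A₃ ^ 2) * w ^ 2 := by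
        refine add_le_add ?_ ?_
        · rw [norm_mul, norm_mul, norm_mul, Complex.norm_I, Complex.norm_real, Real.norm_eq_abs,
            Complex.norm_two, Complex.norm_real, Real.norm_eq_abs, abs_of_pos Real.pi_pos, mul_one]
          gcongr
        · calc ‖∫ b, R b * (ahWt τ w h y' b : ℂ)‖ ≤ ∫ b, ‖R b * (ahWt τ w h y' b : ℂ)‖ :=
                norm_integral_le_integral_norm _
            _ ≤ ∫ b, (4 * π ^ 2 * A₃ ^ 2 * |(ξ : ℝ)| + 4 * π ^ 2 * A₃ ^ 2) * w ^ 2 * ahWt τ w h y' b := by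
                refine integral_mono iR.norm (integrable_real_mul_ahWt hτ w h y' measurable_const
                  (C := (4 * π ^ 2 * A₃ ^ 2 * |(ξ : ℝ)| + 4 * π ^ 2 * A₃ ^ 2) * w ^ 2) fun b _ => by
                    rw [abs_of_nonneg (by positivity)]) fun b => ?_
                · by_cases hb : b ∈ Icc bm bp
                  · rw [norm_mul, Complex.norm_real, Real.norm_eq_abs,
                      abs_of_nonneg (ahWt_nonneg hτ hw0.le hH hwH y' b)]
                    exact mul_le_mul_of_nonneg_right (hRb b hb) (ahWt_nonneg hτ hw0.le hH hwH y' b)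
                  · rw [ahWt_eq_zero hτ y' hb]; simp
            _ = (4 * π ^ 2 * A₃ ^ 2 * |(ξ : ℝ)| + 4 * π ^ 2 * A₃ ^ 2) * w ^ 2 := by
                rw [integral_const_mul, integral_ahWt hτ, mul_one]
    _ ≤ (2 * π * (H * M ^ 2 + A₂) + 8 * π ^ 2 * A₃ ^ 2) * w ^ 2 * (1 + |(ξ : ℝ)|) := by
        have key : (2 * π * (H * M ^ 2 + A₂) + 8 * π ^ 2 * A₃ ^ 2) * w ^ 2 * (1 + |(ξ : ℝ)|) -
            (2 * π * ((H * M ^ 2 + A₂) * w ^ 2) +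
              (4 * π ^ 2 * A₃ ^ 2 * |(ξ : ℝ)| + 4 * π ^ 2 * A₃ ^ 2) * w ^ 2) =
            (2 * π * (H * M ^ 2 + A₂)) * (w ^ 2 * |(ξ : ℝ)|) + 4 * π ^ 2 * A₃ ^ 2 * w ^ 2 +
              4 * π ^ 2 * A₃ ^ 2 * (w ^ 2 * |(ξ : ℝ)|) := by ring
        have h1 : 0 ≤ (2 * π * (H * M ^ 2 + A₂)) * (w ^ 2 * |(ξ : ℝ)|) := by positivity
        have h2 : 0 ≤ 4 * π ^ 2 * A₃ ^ 2 * w ^ 2 := by positivity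
        have h3 : 0 ≤ 4 * π ^ 2 * A₃ ^ 2 * (w ^ 2 * |(ξ : ℝ)|) := by positivity
        linarith

/-- **Second difference**: `|λ(ξ+2) - 2λ(ξ+1) + λ(ξ)| ≤ C₂ w²` (the paper's `|∂²_zλ_k(z)| = 𝒪(1)`,
in difference form: `|e^{2πic} - 1|² ≤ (2π|c|)² = 𝒪(w²)`).
[cite: AjankiHuveneers2011, App. 7.3 (`λ-loc3`)] -/
theorem norm_ahLam_second_diff_le (hτ : ReducedLawHyp τ bm bp) (hH : ∀ z, |h z| ≤ H) :
    ∃ w₀ : ℝ, 0 < w₀ ∧ ∃ C₂ : ℝ, 0 ≤ C₂ ∧ ∀ w ∈ Ioc 0 w₀, ∀ y' : ℝ, ∀ ξ : ℤ,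
      ‖ahLam τ w h y' (ξ + 2) - 2 * ahLam τ w h y' (ξ + 1) + ahLam τ w h y' ξ‖ ≤ C₂ * w ^ 2 := by
  obtain ⟨w₁, hw₁, hw₁1, A₂, hA₂, hcest⟩ := ahC_estimates bm bp
  set M := max |bm| |bp| with hM
  have hM0 : 0 ≤ M := le_max_of_le_left (abs_nonneg _)
  have hH0 : 0 ≤ H := (abs_nonneg _).trans (hH 0)
  set A₃ := M + A₂ with hA₃
  refine ⟨min w₁ (1 / (2 * H * M + 1)), by positivity, 4 * π ^ 2 * A₃ ^ 2, by positivity, ?_⟩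
  intro w hw y' ξ
  obtain ⟨hw0, hwle⟩ := hw
  have hww₁ : w ∈ Ioc 0 w₁ := ⟨hw0, hwle.trans (min_le_left _ _)⟩
  have hwH : w * H * M ≤ 1 / 2 := by
    have : w ≤ 1 / (2 * H * M + 1) := hwle.trans (min_le_right _ _)
    rw [le_div_iff₀ (by positivity)] at this
    nlinarith [mul_nonneg (mul_nonneg hw0.le hH0) hM0]
  have hc : ∀ b ∈ Icc bm bp, |ahC w y' b| ≤ A₃ * w := fun b hb => (hcest w hww₁ y' b hb).2
  set g : ℝ → ℂ := fun b => cexp (2 * π * I * ξ * ahC w y' b) * (cexp (2 * π * I * ahC w y' b) - 1) ^ 2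
    with hg
  have hgm : Measurable g := by
    have hm := Complex.measurable_ofReal.comp (measurable_ahC w y')
    simp only [hg]; fun_prop
  have hgb : ∀ b ∈ Icc bm bp, ‖g b‖ ≤ 4 * π ^ 2 * A₃ ^ 2 * w ^ 2 := fun b hb => by
    simp only [hg]
    rw [norm_mul, norm_cexp_phase, one_mul, norm_pow]
    calc ‖cexp (2 * π * I * ahC w y' b) - 1‖ ^ 2 ≤ (2 * π * (A₃ * w)) ^ 2 := by
          gcongr
          exact (norm_cexp_ahC_sub_one_le _).trans (by gcongr; exact hc b hb)
      _ = 4 * π ^ 2 * A₃ ^ 2 * w ^ 2 := by ring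
  have iG := integrable_mul_ahWt hτ w h y' hgm hgb
  rw [ahLam_second_diff hτ]
  calc ‖∫ b, g b * (ahWt τ w h y' b : ℂ)‖ ≤ ∫ b, ‖g b * (ahWt τ w h y' b : ℂ)‖ :=
        norm_integral_le_integral_norm _
    _ ≤ ∫ b, 4 * π ^ 2 * A₃ ^ 2 * w ^ 2 * ahWt τ w h y' b := by
        refine integral_mono iG.norm (integrable_real_mul_ahWt hτ w h y' measurable_const
          (C := 4 * π ^ 2 * A₃ ^ 2 * w ^ 2) fun b _ => by rw [abs_of_nonneg (by positivity)]) fun b => ?_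
        by_cases hb : b ∈ Icc bm bp
        · rw [norm_mul, Complex.norm_real, Real.norm_eq_abs,
            abs_of_nonneg (ahWt_nonneg hτ hw0.le hH hwH y' b)]
          exact mul_le_mul_of_nonneg_right (hgb b hb) (ahWt_nonneg hτ hw0.le hH hwH y' b)
        · rw [ahWt_eq_zero hτ y' hb]; simp
    _ = 4 * π ^ 2 * A₃ ^ 2 * w ^ 2 := by rw [integral_const_mul, integral_ahWt hτ, mul_one]

/-! #### The Gaussian bound near `ξ = 0` -/

/-- Real and imaginary parts of `λ`: `Re λ = ∫ cos(2πξc) ω`, `Im λ = ∫ sin(2πξc) ω`. [folklore] -/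
theorem ahLam_re_im (hτ : ReducedLawHyp τ bm bp) (w : ℝ) (h : ℝ → ℝ) (y' : ℝ) (ξ : ℤ) :
    (ahLam τ w h y' ξ).re = ∫ b, Real.cos (2 * π * ξ * ahC w y' b) * ahWt τ w h y' b ∧
    (ahLam τ w h y' ξ).im = ∫ b, Real.sin (2 * π * ξ * ahC w y' b) * ahWt τ w h y' b := by
  have hI := integrable_ahLam_integrand hτ w h y' ξ
  unfold ahLam
  constructor
  · rw [← Complex.reCLM_apply (∫ b, _), ← ContinuousLinearMap.integral_comp_comm _ hI]
    refine integral_congr_ae (ae_of_all _ fun b => ?_)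
    dsimp only
    rw [Complex.reCLM_apply, cexp_phase_eq, Complex.re_mul_ofReal, Complex.exp_ofReal_mul_I_re]
  · rw [← Complex.imCLM_apply (∫ b, _), ← ContinuousLinearMap.integral_comp_comm _ hI]
    refine integral_congr_ae (ae_of_all _ fun b => ?_)
    dsimp only
    rw [Complex.imCLM_apply, cexp_phase_eq, Complex.im_mul_ofReal, Complex.exp_ofReal_mul_I_im]

/-- **The Gaussian bound**: for `|ξ|w ≤ ε₀` and `w ≤ w₀`,
`|λ(y', ξ)|² ≤ 1 - (3/2)π²σ²φ(y')²(ξw)² + C_E w (ξw)²` with `σ² = ∫ b²τ`, `φ = sin²(π·)` — the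
paper's "`|λ_k(z)| = exp[-((2π)²/2) z² α_k² 𝔼(B²) + 𝒪(z²w + |z|³)]`" in the quantitative form we
need (second-order Taylor expansion of `e^{iθ}`, `∫ τ = 1`, `∫ bτ = 0`; the imaginary part is
`𝒪(w|z|)` and enters squared). [cite: AjankiHuveneers2011, App. 7.3 (`λ-loc1`)] -/
theorem norm_sq_ahLam_le (hτ : ReducedLawHyp τ bm bp) (hH : ∀ z, |h z| ≤ H) :
    ∃ w₀ : ℝ, 0 < w₀ ∧ ∃ ε₀ : ℝ, 0 < ε₀ ∧ ∃ CE : ℝ, 0 ≤ CE ∧ ∀ w ∈ Ioc 0 w₀, ∀ y' : ℝ, ∀ ξ : ℤ,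
      |(ξ : ℝ)| * w ≤ ε₀ →
        ‖ahLam τ w h y' ξ‖ ^ 2 ≤ 1 - 3 / 2 * π ^ 2 * (∫ b, b ^ 2 * τ b) * (Real.sin (π * y') ^ 2) ^ 2 *
          ((ξ : ℝ) * w) ^ 2 + CE * w * ((ξ : ℝ) * w) ^ 2 := by
  obtain ⟨w₁, hw₁, hw₁1, A₂, hA₂, hcest⟩ := ahC_estimates bm bp
  obtain ⟨M, hM⟩ : ∃ M : ℝ, M = max |bm| |bp| := ⟨_, rfl⟩
  have hM0 : 0 ≤ M := hM ▸ le_max_of_le_left (abs_nonneg _)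
  have hH0 : 0 ≤ H := (abs_nonneg _).trans (hH 0)
  obtain ⟨A₃, hA₃⟩ : ∃ A₃ : ℝ, A₃ = M + A₂ := ⟨_, rfl⟩
  have hA₃0 : 0 ≤ A₃ := by rw [hA₃]; positivity
  obtain ⟨σ2, hσ2⟩ : ∃ σ2 : ℝ, σ2 = ∫ b, b ^ 2 * τ b := ⟨_, rfl⟩
  have h3 : |∫ b, b ^ 3 * τ b| ≤ M ^ 3 := hM ▸ abs_integral_pow_mul_le hτ 3
  refine ⟨min w₁ (1 / (2 * H * M + 1)), by positivity, 1 / (8 * π * A₃ + 1), by positivity,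
    3 / 2 * π ^ 2 * (H * M ^ 3 + 2 * M * A₂) + 8 * π ^ 2 * (H * M ^ 2 + A₂) ^ 2, by positivity, ?_⟩
  intro w hw y' ξ hξ
  rw [← hσ2]
  obtain ⟨hw0, hwle⟩ := hw
  have hww₁ : w ∈ Ioc 0 w₁ := ⟨hw0, hwle.trans (min_le_left _ _)⟩
  have hw1 : w ≤ 1 := hww₁.2.trans hw₁1
  have hwH : w * H * max |bm| |bp| ≤ 1 / 2 := by
    rw [← hM]
    have : w ≤ 1 / (2 * H * M + 1) := hwle.trans (min_le_right _ _)
    rw [le_div_iff₀ (by positivity)] at this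
    nlinarith [mul_nonneg (mul_nonneg hw0.le hH0) hM0]
  have hc : ∀ b ∈ Icc bm bp, |ahC w y' b| ≤ A₃ * w := fun b hb => by
    rw [hA₃, hM]; exact (hcest w hww₁ y' b hb).2
  obtain ⟨α, hα⟩ : ∃ α : ℝ, α = Real.sin (π * y') ^ 2 := ⟨_, rfl⟩
  rw [← hα]
  have hce : ∀ b ∈ Icc bm bp, |ahC w y' b - w * α * b| ≤ A₂ * w ^ 2 := fun b hb => by
    rw [hα]; exact (hcest w hww₁ y' b hb).1
  have hα0 : 0 ≤ α := hα ▸ sq_nonneg _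
  have hα1 : α ≤ 1 := hα ▸ Real.sin_sq_le_one _
  obtain ⟨z, hz⟩ : ∃ z : ℝ, z = (ξ : ℝ) * w := ⟨_, rfl⟩
  rw [← hz]
  -- the phase and its size `Θ ≤ 1/4`
  obtain ⟨θ, hθ⟩ : ∃ θ : ℝ → ℝ, θ = fun b => 2 * π * ξ * ahC w y' b := ⟨_, rfl⟩
  have hθm : Measurable θ := by rw [hθ]; exact (measurable_ahC w y').const_mul _
  obtain ⟨Θ, hΘ⟩ : ∃ Θ : ℝ, Θ = 2 * π * A₃ * (|(ξ : ℝ)| * w) := ⟨_, rfl⟩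
  have hΘ0 : 0 ≤ Θ := by rw [hΘ]; positivity
  have hΘ4 : Θ ≤ 1 / 4 := by
    rw [hΘ]
    have : |(ξ : ℝ)| * w ≤ 1 / (8 * π * A₃ + 1) := hξ
    rw [le_div_iff₀ (by positivity)] at this
    have e : |(ξ : ℝ)| * w * (8 * π * A₃ + 1) = 4 * (2 * π * A₃ * (|(ξ : ℝ)| * w)) + |(ξ : ℝ)| * w := by
      ring
    have ht : 0 ≤ |(ξ : ℝ)| * w := by positivity
    linarith
  have hΘ16 : Θ ^ 2 ≤ 1 / 16 := by
    have := pow_le_pow_left₀ hΘ0 hΘ4 2; norm_num at this; exact this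
  have hθb : ∀ b ∈ Icc bm bp, |θ b| ≤ Θ := fun b hb => by
    rw [hθ, hΘ]
    dsimp only
    rw [abs_mul, abs_mul, abs_mul, abs_of_pos Real.pi_pos, abs_two]
    calc 2 * π * |(ξ : ℝ)| * |ahC w y' b| ≤ 2 * π * |(ξ : ℝ)| * (A₃ * w) := by gcongr; exact hc b hb
      _ = 2 * π * A₃ * (|(ξ : ℝ)| * w) := by ring
  have hθ1 : ∀ b ∈ Icc bm bp, |θ b| ≤ 1 := fun b hb => (hθb b hb).trans (by linarith)
  have hθsq : ∀ b ∈ Icc bm bp, θ b ^ 2 ≤ Θ ^ 2 := fun b hb => by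
    rw [← sq_abs]; exact pow_le_pow_left₀ (abs_nonneg _) (hθb b hb) 2
  -- weights
  have hω0 : ∀ b, 0 ≤ ahWt τ w h y' b := ahWt_nonneg hτ hw0.le hH hwH y'
  have hωI := integral_ahWt hτ w h y'
  have hωint := integrable_ahWt hτ w h y'
  -- the second moment of the phase
  obtain ⟨T₂, hT₂⟩ : ∃ T₂ : ℝ, T₂ = ∫ b, θ b ^ 2 * ahWt τ w h y' b := ⟨_, rfl⟩
  have iθ2 : Integrable fun b => θ b ^ 2 * ahWt τ w h y' b :=
    integrable_real_mul_ahWt hτ w h y' (hθm.pow_const 2) (C := Θ ^ 2) fun b hb => by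
      rw [abs_pow, sq_abs]; exact hθsq b hb
  have hT₂0 : 0 ≤ T₂ := hT₂ ▸ integral_nonneg fun b => mul_nonneg (sq_nonneg _) (hω0 b)
  have hT₂le : T₂ ≤ Θ ^ 2 := by
    rw [hT₂]
    calc ∫ b, θ b ^ 2 * ahWt τ w h y' b ≤ ∫ b, Θ ^ 2 * ahWt τ w h y' b := by
          refine integral_mono iθ2 (hωint.const_mul _) fun b => ?_
          by_cases hb : b ∈ Icc bm bp
          · exact mul_le_mul_of_nonneg_right (hθsq b hb) (hω0 b)
          · simp [ahWt_eq_zero hτ y' hb]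
      _ = Θ ^ 2 := by rw [integral_const_mul, hωI, mul_one]
  have hT16 : T₂ ≤ 1 / 16 := hT₂le.trans hΘ16
  obtain ⟨hre, him⟩ := ahLam_re_im hτ w h y' ξ
  have hre' : (ahLam τ w h y' ξ).re = ∫ b, Real.cos (θ b) * ahWt τ w h y' b := by rw [hre, hθ]
  have him' : (ahLam τ w h y' ξ).im = ∫ b, Real.sin (θ b) * ahWt τ w h y' b := by rw [him, hθ]
  -- real part: `0 ≤ Re λ ≤ 1 - (7/16) T₂`
  have iC : Integrable fun b => Real.cos (θ b) * ahWt τ w h y' b :=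
    integrable_real_mul_ahWt hτ w h y' (Real.measurable_cos.comp hθm) (C := 1)
      fun b _ => Real.abs_cos_le_one _
  have hRe0 : 0 ≤ (ahLam τ w h y' ξ).re := by
    rw [hre']
    refine integral_nonneg fun b => ?_
    by_cases hb : b ∈ Icc bm bp
    · refine mul_nonneg ?_ (hω0 b)
      have h1 := Real.one_sub_sq_div_two_le_cos (x := θ b)
      have h2 : θ b ^ 2 ≤ 1 := by
        rw [← sq_abs]; exact pow_le_one₀ (abs_nonneg _) (hθ1 b hb)
      linarith
    · simp [ahWt_eq_zero hτ y' hb]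
  have hRe1 : (ahLam τ w h y' ξ).re ≤ 1 - 7 / 16 * T₂ := by
    rw [hre']
    calc ∫ b, Real.cos (θ b) * ahWt τ w h y' b ≤ ∫ b, (1 - 7 / 16 * θ b ^ 2) * ahWt τ w h y' b := by
          refine integral_mono iC ?_ fun b => ?_
          · have : (fun b => (1 - 7 / 16 * θ b ^ 2) * ahWt τ w h y' b) =
                fun b => ahWt τ w h y' b - 7 / 16 * (θ b ^ 2 * ahWt τ w h y' b) := by funext b; ring
            rw [this]
            exact hωint.sub (iθ2.const_mul _)
          · by_cases hb : b ∈ Icc bm bp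
            · refine mul_le_mul_of_nonneg_right ?_ (hω0 b)
              have h1 := (abs_le.mp (abs_cos_sub_le (hθ1 b hb))).2
              have h2 : θ b ^ 4 ≤ 1 / 16 * θ b ^ 2 := by
                calc θ b ^ 4 = θ b ^ 2 * θ b ^ 2 := by ring
                  _ ≤ Θ ^ 2 * θ b ^ 2 := mul_le_mul_of_nonneg_right (hθsq b hb) (sq_nonneg _)
                  _ ≤ 1 / 16 * θ b ^ 2 := mul_le_mul_of_nonneg_right hΘ16 (sq_nonneg _)
              linarith
            · simp [ahWt_eq_zero hτ y' hb]
      _ = 1 - 7 / 16 * T₂ := by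
          have : (fun b => (1 - 7 / 16 * θ b ^ 2) * ahWt τ w h y' b) =
              fun b => ahWt τ w h y' b - 7 / 16 * (θ b ^ 2 * ahWt τ w h y' b) := by funext b; ring
          rw [this, integral_sub hωint (iθ2.const_mul _), integral_const_mul, hωI, hT₂]
  -- imaginary part: `|Im λ| ≤ m₁ + Θ T₂`
  obtain ⟨m₁, hm₁⟩ : ∃ m₁ : ℝ, m₁ = |∫ b, θ b * ahWt τ w h y' b| := ⟨_, rfl⟩
  have hm0 : 0 ≤ m₁ := hm₁ ▸ abs_nonneg _
  have iθ : Integrable fun b => θ b * ahWt τ w h y' b :=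
    integrable_real_mul_ahWt hτ w h y' hθm (C := Θ) hθb
  have iS : Integrable fun b => Real.sin (θ b) * ahWt τ w h y' b :=
    integrable_real_mul_ahWt hτ w h y' (Real.measurable_sin.comp hθm) (C := 1)
      fun b _ => Real.abs_sin_le_one _
  have iD : Integrable fun b => (Real.sin (θ b) - θ b) * ahWt τ w h y' b :=
    (iS.sub iθ).congr (ae_of_all _ fun b => by simp only [Pi.sub_apply]; ring)
  have hIm : |(ahLam τ w h y' ξ).im| ≤ m₁ + Θ * T₂ := by
    rw [him', hm₁]
    have hsplit : ∫ b, Real.sin (θ b) * ahWt τ w h y' b =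
        (∫ b, θ b * ahWt τ w h y' b) + ∫ b, (Real.sin (θ b) - θ b) * ahWt τ w h y' b := by
      rw [← integral_add iθ iD]
      exact integral_congr_ae (ae_of_all _ fun b => by ring)
    rw [hsplit]
    refine (abs_add_le _ _).trans (add_le_add le_rfl ?_)
    calc |∫ b, (Real.sin (θ b) - θ b) * ahWt τ w h y' b|
        ≤ ∫ b, |(Real.sin (θ b) - θ b) * ahWt τ w h y' b| := abs_integral_le_integral_abs
      _ ≤ ∫ b, Θ * (θ b ^ 2 * ahWt τ w h y' b) := by
          refine integral_mono iD.abs (iθ2.const_mul _) fun b => ?_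
          by_cases hb : b ∈ Icc bm bp
          · rw [abs_mul, abs_of_nonneg (hω0 b), ← mul_assoc]
            refine mul_le_mul_of_nonneg_right ?_ (hω0 b)
            calc |Real.sin (θ b) - θ b| ≤ |θ b| ^ 3 := abs_sin_sub_self_le (hθ1 b hb)
              _ = |θ b| * θ b ^ 2 := by rw [← sq_abs]; ring
              _ ≤ Θ * θ b ^ 2 := mul_le_mul_of_nonneg_right (hθb b hb) (sq_nonneg _)
          · simp [ahWt_eq_zero hτ y' hb]
      _ = Θ * T₂ := by rw [integral_const_mul, hT₂]
  -- `‖λ‖² ≤ 1 - (3/8) T₂ + 2 m₁²`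
  have hnorm : ‖ahLam τ w h y' ξ‖ ^ 2 ≤ 1 - 3 / 8 * T₂ + 2 * m₁ ^ 2 := by
    rw [Complex.sq_norm, Complex.normSq_apply]
    have hu1 : 1 - 7 / 16 * T₂ ≤ 1 := by linarith
    have hu0 : 0 ≤ 1 - 7 / 16 * T₂ := hRe0.trans hRe1
    have hre2 : (ahLam τ w h y' ξ).re * (ahLam τ w h y' ξ).re ≤ 1 - 7 / 16 * T₂ := by
      calc (ahLam τ w h y' ξ).re * (ahLam τ w h y' ξ).re ≤ (1 - 7 / 16 * T₂) * (1 - 7 / 16 * T₂) :=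
            mul_le_mul hRe1 hRe1 hRe0 hu0
        _ ≤ (1 - 7 / 16 * T₂) * 1 := mul_le_mul_of_nonneg_left hu1 hu0
        _ = 1 - 7 / 16 * T₂ := mul_one _
    have him2 : (ahLam τ w h y' ξ).im * (ahLam τ w h y' ξ).im ≤ 2 * m₁ ^ 2 + 2 * (Θ * T₂) ^ 2 := by
      have h1 : (ahLam τ w h y' ξ).im * (ahLam τ w h y' ξ).im = |(ahLam τ w h y' ξ).im| ^ 2 := by
        rw [sq_abs, sq]
      rw [h1]
      have h2 : |(ahLam τ w h y' ξ).im| ^ 2 ≤ (m₁ + Θ * T₂) ^ 2 := pow_le_pow_left₀ (abs_nonneg _) hIm 2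
      nlinarith [h2, sq_nonneg (m₁ - Θ * T₂)]
    have hΘT : 2 * (Θ * T₂) ^ 2 ≤ 1 / 128 * T₂ := by
      calc 2 * (Θ * T₂) ^ 2 = 2 * Θ ^ 2 * T₂ * T₂ := by ring
        _ ≤ 2 * (1 / 16) * T₂ * (1 / 16) := by gcongr
        _ = 1 / 128 * T₂ := by ring
    linarith
  -- `T₂ ≥ 4π² z² (α² σ² - w (H M³ + 2 M A₂))`
  have ib2 : Integrable fun b => b ^ 2 * ahWt τ w h y' b :=
    integrable_real_mul_ahWt hτ w h y' (by fun_prop) (C := M ^ 2) fun b hb => by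
      rw [abs_pow, hM]; exact pow_le_pow_left₀ (abs_nonneg _) (ReducedLawHyp.abs_le_of_mem hb) 2
  have ic2 : Integrable fun b => ahC w y' b ^ 2 * ahWt τ w h y' b :=
    integrable_real_mul_ahWt hτ w h y' ((measurable_ahC w y').pow_const 2) (C := (A₃ * w) ^ 2)
      fun b hb => by rw [abs_pow]; exact pow_le_pow_left₀ (abs_nonneg _) (hc b hb) 2
  have hlow : ∫ b, ((w * α) ^ 2 * b ^ 2 - 2 * M * A₂ * w ^ 3) * ahWt τ w h y' b ≤
      ∫ b, ahC w y' b ^ 2 * ahWt τ w h y' b := by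
    refine integral_mono ?_ ic2 fun b => ?_
    · have : (fun b => ((w * α) ^ 2 * b ^ 2 - 2 * M * A₂ * w ^ 3) * ahWt τ w h y' b) =
          fun b => (w * α) ^ 2 * (b ^ 2 * ahWt τ w h y' b) - 2 * M * A₂ * w ^ 3 * ahWt τ w h y' b := by
        funext b; ring
      rw [this]
      exact (ib2.const_mul _).sub (hωint.const_mul _)
    · by_cases hb : b ∈ Icc bm bp
      · refine mul_le_mul_of_nonneg_right ?_ (hω0 b)
        have he := hce b hb
        have hbM : |b| ≤ M := hM ▸ ReducedLawHyp.abs_le_of_mem hb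
        have h1 : |w * α * b * (ahC w y' b - w * α * b)| ≤ w * 1 * M * (A₂ * w ^ 2) := by
          rw [abs_mul, abs_mul, abs_mul, abs_of_pos hw0, abs_of_nonneg hα0]
          gcongr
        have e1 : ahC w y' b ^ 2 = (w * α) ^ 2 * b ^ 2 + 2 * (w * α * b * (ahC w y' b - w * α * b)) +
            (ahC w y' b - w * α * b) ^ 2 := by ring
        rw [e1]
        linarith [sq_nonneg (ahC w y' b - w * α * b), neg_abs_le (w * α * b * (ahC w y' b - w * α * b))]
      · simp [ahWt_eq_zero hτ y' hb]
  obtain ⟨Q, hQ⟩ : ∃ Q : ℝ, Q = h y' * ∫ b, b ^ 3 * τ b := ⟨_, rfl⟩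
  have hlhs : ∫ b, ((w * α) ^ 2 * b ^ 2 - 2 * M * A₂ * w ^ 3) * ahWt τ w h y' b =
      (w * α) ^ 2 * (σ2 + w * Q) - 2 * M * A₂ * w ^ 3 := by
    have : (fun b => ((w * α) ^ 2 * b ^ 2 - 2 * M * A₂ * w ^ 3) * ahWt τ w h y' b) =
        fun b => (w * α) ^ 2 * (b ^ 2 * ahWt τ w h y' b) - 2 * M * A₂ * w ^ 3 * ahWt τ w h y' b := by
      funext b; ring
    rw [this, integral_sub (ib2.const_mul _) (hωint.const_mul _), integral_const_mul, integral_const_mul,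
      integral_sq_mul_ahWt hτ, hωI, mul_one, hQ, hσ2]
    ring
  have hT₂eq : T₂ = (2 * π * ξ) ^ 2 * ∫ b, ahC w y' b ^ 2 * ahWt τ w h y' b := by
    rw [hT₂, ← integral_const_mul]
    refine integral_congr_ae (ae_of_all _ fun b => ?_)
    rw [hθ]; dsimp only; ring
  have hQb : |Q| ≤ H * M ^ 3 := by
    rw [hQ, abs_mul]; exact mul_le_mul (hH y') h3 (abs_nonneg _) hH0
  have hα2 : α ^ 2 ≤ 1 := pow_le_one₀ hα0 hα1
  have key : w ^ 2 * (α ^ 2 * σ2 - w * (H * M ^ 3 + 2 * M * A₂)) ≤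
      (w * α) ^ 2 * (σ2 + w * Q) - 2 * M * A₂ * w ^ 3 := by
    have q1 : 0 ≤ α ^ 2 * (Q + |Q|) := mul_nonneg (sq_nonneg _) (by linarith [neg_abs_le Q])
    have q2 : α ^ 2 * |Q| ≤ 1 * |Q| := mul_le_mul_of_nonneg_right hα2 (abs_nonneg Q)
    have q3 : 0 ≤ α ^ 2 * Q + H * M ^ 3 := by linarith
    have q4 : 0 ≤ w ^ 3 * (α ^ 2 * Q + H * M ^ 3) := mul_nonneg (pow_nonneg hw0.le 3) q3
    have e : (w * α) ^ 2 * (σ2 + w * Q) - 2 * M * A₂ * w ^ 3 -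
        w ^ 2 * (α ^ 2 * σ2 - w * (H * M ^ 3 + 2 * M * A₂)) = w ^ 3 * (α ^ 2 * Q + H * M ^ 3) := by ring
    linarith
  have hT₂low : 4 * π ^ 2 * z ^ 2 * (α ^ 2 * σ2 - w * (H * M ^ 3 + 2 * M * A₂)) ≤ T₂ := by
    rw [hT₂eq]
    calc 4 * π ^ 2 * z ^ 2 * (α ^ 2 * σ2 - w * (H * M ^ 3 + 2 * M * A₂))
        = (2 * π * ξ) ^ 2 * (w ^ 2 * (α ^ 2 * σ2 - w * (H * M ^ 3 + 2 * M * A₂))) := by rw [hz]; ring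
      _ ≤ (2 * π * ξ) ^ 2 * ∫ b, ahC w y' b ^ 2 * ahWt τ w h y' b :=
          mul_le_mul_of_nonneg_left (key.trans (hlhs ▸ hlow)) (sq_nonneg _)
  -- `m₁ ≤ 2π (H M² + A₂) w |z|`
  have iB : Integrable fun b => b * ahWt τ w h y' b :=
    integrable_real_mul_ahWt hτ w h y' measurable_id (C := M) fun b hb =>
      hM ▸ ReducedLawHyp.abs_le_of_mem hb
  have iE : Integrable fun b => (ahC w y' b - w * α * b) * ahWt τ w h y' b :=
    integrable_real_mul_ahWt hτ w h y' ((measurable_ahC w y').sub (measurable_const.mul measurable_id))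
      (C := A₂ * w ^ 2) fun b hb => hce b hb
  have hE : |∫ b, (ahC w y' b - w * α * b) * ahWt τ w h y' b| ≤ A₂ * w ^ 2 := by
    calc _ ≤ ∫ b, |(ahC w y' b - w * α * b) * ahWt τ w h y' b| := abs_integral_le_integral_abs
      _ ≤ ∫ b, A₂ * w ^ 2 * ahWt τ w h y' b := by
          refine integral_mono iE.abs (hωint.const_mul _) fun b => ?_
          by_cases hb : b ∈ Icc bm bp
          · rw [abs_mul, abs_of_nonneg (hω0 b)]
            exact mul_le_mul_of_nonneg_right (hce b hb) (hω0 b)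
          · simp [ahWt_eq_zero hτ y' hb]
      _ = A₂ * w ^ 2 := by rw [integral_const_mul, hωI, mul_one]
  have hcω : |∫ b, ahC w y' b * ahWt τ w h y' b| ≤ (H * M ^ 2 + A₂) * w ^ 2 := by
    have hsplit : (fun b => ahC w y' b * ahWt τ w h y' b) = fun b =>
        (w * α) * (b * ahWt τ w h y' b) + (ahC w y' b - w * α * b) * ahWt τ w h y' b := by
      funext b; ring
    rw [hsplit, integral_add (iB.const_mul _) iE, integral_const_mul, integral_mul_ahWt hτ, ← hσ2]
    have hσb : |σ2| ≤ M ^ 2 := by rw [hσ2, hM]; exact abs_integral_pow_mul_le hτ 2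
    calc |w * α * (w * h y' * σ2) + ∫ b, (ahC w y' b - w * α * b) * ahWt τ w h y' b|
        ≤ |w * α * (w * h y' * σ2)| + |∫ b, (ahC w y' b - w * α * b) * ahWt τ w h y' b| := abs_add_le _ _
      _ ≤ w * 1 * (w * H * M ^ 2) + A₂ * w ^ 2 := by
          refine add_le_add ?_ hE
          rw [abs_mul, abs_mul, abs_of_pos hw0, abs_of_nonneg hα0, abs_mul, abs_mul, abs_of_pos hw0]
          gcongr
          exact hH y'
      _ = (H * M ^ 2 + A₂) * w ^ 2 := by ring
  have hm₁le : m₁ ≤ 2 * π * (H * M ^ 2 + A₂) * w * |z| := by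
    have hm₁eq : m₁ = 2 * π * |(ξ : ℝ)| * |∫ b, ahC w y' b * ahWt τ w h y' b| := by
      rw [hm₁]
      have : (fun b => θ b * ahWt τ w h y' b) = fun b => (2 * π * ξ) * (ahC w y' b * ahWt τ w h y' b) := by
        funext b; rw [hθ]; dsimp only; ring
      rw [this, integral_const_mul, abs_mul, abs_mul, abs_mul, abs_of_pos Real.pi_pos, abs_two]
    rw [hm₁eq, hz, abs_mul, abs_of_pos hw0]
    calc 2 * π * |(ξ : ℝ)| * |∫ b, ahC w y' b * ahWt τ w h y' b|
        ≤ 2 * π * |(ξ : ℝ)| * ((H * M ^ 2 + A₂) * w ^ 2) := by gcongr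
      _ = 2 * π * (H * M ^ 2 + A₂) * w * (|(ξ : ℝ)| * w) := by ring
  -- assemble
  have hm₁sq : 2 * m₁ ^ 2 ≤ 8 * π ^ 2 * (H * M ^ 2 + A₂) ^ 2 * w * z ^ 2 := by
    have h1 : m₁ ^ 2 ≤ (2 * π * (H * M ^ 2 + A₂) * w * |z|) ^ 2 := pow_le_pow_left₀ hm0 hm₁le 2
    rw [mul_pow, mul_pow, mul_pow, mul_pow, sq_abs] at h1
    have hw2 : w ^ 2 ≤ w := pow_le_of_le_one hw0.le hw1 two_ne_zero
    have h2 : 2 ^ 2 * π ^ 2 * (H * M ^ 2 + A₂) ^ 2 * w ^ 2 * z ^ 2 ≤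
        2 ^ 2 * π ^ 2 * (H * M ^ 2 + A₂) ^ 2 * w * z ^ 2 := by
      have := mul_le_mul_of_nonneg_left hw2 (by positivity : (0:ℝ) ≤ 2 ^ 2 * π ^ 2 * (H * M ^ 2 + A₂) ^ 2 * z ^ 2)
      linarith [this]
    linarith [h1, h2]
  linarith [hnorm, hT₂low, hm₁sq]

end Setup

end Literature.Barriers.AtomisticToContinuum.HeatConduction
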